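import Mathlib
import Summits.Ventures.PercRepro2.SwOutCrossJunctionSw

/-!
# The witness of the finding: the conditioning is not a function of the outside bits and the
within-component links (blind cell PercRepro2, night-4 g25, 2026-08-28; proofs/NIGHT4-G25.md §0)

The graph `findEx` on `Fin 8` (`l = 0`, `h = 1`, `o = 2` OUTSIDE the region, the junction `u = 3`,
two dropped vertices `p₁ = 4`, `p₂ = 5` in SEPARATE components (no cross edge), the u-arm
`x = 6`, the outside vertex `a = 7`) with the eight edges `hx, ux, up₁, up₂, p₁a, p₂o, al, xl` and
the region `U = {h, u, p₁, p₂, x}`.  The two configurations `findζ₁` (the u-arm blue, both u–p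
edges red, every outside edge red) and `findζ₂ = findζ₁` with the u–`p₁` edge blue have the same
u-arm bit, the same outside bits and — the components being single vertices — the same links
inside every component; they differ only in the colour of the u–`p₁` edge.  Both lie in the
outside class, `findζ₁` lies in the conditioning `Q = tgtU l h {S | o ∈ S}` (`o` is red-reached
from `l` along `l – a – p₁ – u – p₂ – o`, through the junction), `findζ₂` does not
(`findζ₂_notMem_tgtU`).  So no label that records only the outside bits and the links inside the
components can determine the conditioning — the PRODUCT type of NIGHT4-G24 §11 cannot be the
type of the geometric type lemma, and a label of the links ACROSS the components through `u`
(the joint label of this seat) is needed.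
-/

namespace Summit.Ventures.PercRepro2

namespace CrossArm

open Hull LocRows

open scoped Classical

/-- The graph: `l = 0`, `h = 1`, `o = 2`, `u = 3`, `p₁ = 4`, `p₂ = 5`, `x = 6`, `a = 7`. -/
def findEx : Fin 8 → Sym2 (Fin 8)
  | 0 => s(1, 6) | 1 => s(3, 6) | 2 => s(3, 4) | 3 => s(3, 5) | 4 => s(4, 7) | 5 => s(5, 2)
  | 6 => s(7, 0) | 7 => s(6, 0)

/-- The region `U = {h, u, p₁, p₂, x}`. -/
def findU : Set (Fin 8) := ↑({1, 3, 4, 5, 6} : Finset (Fin 8))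

/-- The first configuration: `hx`, `ux` blue, everything else red. -/
def findζ₁ : Config (Fin 8) := ![false, false, true, true, true, true, true, true]

/-- The second configuration: `findζ₁` with the u–`p₁` edge blue. -/
def findζ₂ : Config (Fin 8) := ![false, false, false, true, true, true, true, true]

/-- The two configurations differ only at the u–`p₁` edge. -/
theorem findζ₂_eq : findζ₂ = Function.update findζ₁ 2 false := by
  funext e
  fin_cases e <;> rfl

/-- A red-cluster closure check on `findEx`: a finite vertex set closed under the open edges of a
configuration contains the cluster of each of its vertices. -/
lemma findEx_cluster_subset (ω : Config (Fin 8)) (S : Finset (Fin 8))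
    (hS : ∀ x ∈ S, ∀ e : Fin 8, ω e = true → ∀ y : Fin 8, findEx e = s(x, y) → y ∈ S) {v : Fin 8}
    (hv : v ∈ S) : cluster findEx ω v ⊆ ↑S := by
  intro w hw
  refine mem_of_conn_of_closed (ends := findEx) (ω := ω) (S := ↑S) ?_ hv hw
  intro x hx y hxy
  rw [openGraph_adj] at hxy
  obtain ⟨-, e, he, hends⟩ := hxy
  exact hS x hx e he y hends

/-- An open edge of `findEx` connects its ends. -/
lemma findEx_conn {ω : Config (Fin 8)} (e : Fin 8) (he : ω e = true) {x y : Fin 8}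
    (hxy : findEx e = s(x, y)) : Conn findEx ω x y :=
  conn_of_openAdj ⟨e, he, hxy⟩

/-- **`findζ₁` lies in the conditioning**: `h` is outside the hull of `l`, `o` is red-reached from
`l` through the junction (`l – a – p₁ – u – p₂ – o`), `o` is not blue-reached. -/
theorem findζ₁_mem_tgtU : findζ₁ ∈ tgtU findEx 0 1 {S : Set (Fin 8) | 2 ∈ S} := by
  simp only [tgtU, Finset.mem_filter, Finset.mem_univ, true_and, Set.mem_setOf_eq]
  refine ⟨?_, ?_, ?_⟩
  · -- the hull of `l`: the red cluster `{0, 7, 6, 4, 3, 5, 2}`, the blue cluster `{0}`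
    intro h1
    rcases h1 with h1 | h1
    · have := findEx_cluster_subset findζ₁ {0, 7, 6, 4, 3, 5, 2} (by decide) (by decide) h1
      revert this; decide
    · have := findEx_cluster_subset (blue findζ₁) {0} (by decide) (by decide) h1
      revert this; decide
  · -- `l – a – p₁ – u – p₂ – o`
    have h1 : Conn findEx findζ₁ 0 7 := findEx_conn 6 rfl (by decide)
    have h2 : Conn findEx findζ₁ 7 4 := findEx_conn 4 rfl (by decide)
    have h3 : Conn findEx findζ₁ 4 3 := findEx_conn 2 rfl (by decide)
    have h4 : Conn findEx findζ₁ 3 5 := findEx_conn 3 rfl (by decide)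
    have h5 : Conn findEx findζ₁ 5 2 := findEx_conn 5 rfl (by decide)
    exact conn_trans h1 (conn_trans h2 (conn_trans h3 (conn_trans h4 h5)))
  · intro h2
    have := findEx_cluster_subset (blue findζ₁) {0} (by decide) (by decide) h2
    revert this; decide

/-- **`findζ₂` does not lie in the conditioning**: with the u–`p₁` edge blue, `o` is not red-reached
from `l` (the red cluster of `l` is `{0, 7, 6, 4}`). -/
theorem findζ₂_notMem_tgtU : findζ₂ ∉ tgtU findEx 0 1 {S : Set (Fin 8) | 2 ∈ S} := by
  simp only [tgtU, Finset.mem_filter, Finset.mem_univ, true_and, Set.mem_setOf_eq]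
  rintro ⟨-, h2, -⟩
  have := findEx_cluster_subset findζ₂ {0, 7, 6, 4} (by decide) (by decide) h2
  revert this; decide

/-- Both configurations lie in the outside class of the region `U` with the outside colouring
`findζ₁` (they agree off the edges touching `U` — the only such edge is `al` — and the hull of `h`
lies inside `U`). -/
theorem find_mem_outClass : findζ₁ ∈ outClass findEx findU 1 findζ₁ ∧
    findζ₂ ∈ outClass findEx findU 1 findζ₁ := by
  refine ⟨?_, ?_⟩
  · rw [mem_outClass]
    refine ⟨fun _ _ => rfl, ?_⟩
    intro y hy
    show y ∈ ({1, 3, 4, 5, 6} : Finset (Fin 8))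
    rcases hy with hy | hy
    · have hS := findEx_cluster_subset findζ₁ {1} (by decide) (by decide) hy
      rw [Finset.mem_coe] at hS
      clear hy; revert y; decide
    · have hS := findEx_cluster_subset (blue findζ₁) {1, 6, 3} (by decide) (by decide) hy
      rw [Finset.mem_coe] at hS
      clear hy; revert y; decide
  · rw [mem_outClass]
    refine ⟨fun e he => ?_, ?_⟩
    · fin_cases e
      · exact absurd ⟨1, by simp [findU], 6, rfl⟩ he
      · exact absurd ⟨3, by simp [findU], 6, rfl⟩ he
      · exact absurd ⟨3, by simp [findU], 4, rfl⟩ he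
      · exact absurd ⟨3, by simp [findU], 5, rfl⟩ he
      · exact absurd ⟨4, by simp [findU], 7, rfl⟩ he
      · exact absurd ⟨5, by simp [findU], 2, rfl⟩ he
      · rfl
      · exact absurd ⟨6, by simp [findU], 0, rfl⟩ he
    · intro y hy
      show y ∈ ({1, 3, 4, 5, 6} : Finset (Fin 8))
      rcases hy with hy | hy
      · have hS := findEx_cluster_subset findζ₂ {1} (by decide) (by decide) hy
        rw [Finset.mem_coe] at hS
        clear hy; revert y; decide
      · have hS := findEx_cluster_subset (blue findζ₂) {1, 6, 3, 4} (by decide) (by decide) hy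
        rw [Finset.mem_coe] at hS
        clear hy; revert y; decide

/-- **THE WITNESS**: two configurations of one outside class, differing only in the colour of the
u–`p₁` edge, one in the conditioning and one not — the conditioning is not a function of the
outside bits and the links inside the components. -/
theorem finding_witness : findζ₂ = Function.update findζ₁ 2 false ∧
    findζ₁ ∈ swOutSide findEx 0 1 2 findU findζ₁ ∧ findζ₂ ∈ outClass findEx findU 1 findζ₁ ∧
    findζ₂ ∉ tgtU findEx 0 1 {S : Set (Fin 8) | 2 ∈ S} :=
  ⟨findζ₂_eq, mem_swOutSide.2 ⟨findζ₁_mem_tgtU, find_mem_outClass.1⟩, find_mem_outClass.2,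
    findζ₂_notMem_tgtU⟩

end CrossArm

end Summit.Ventures.PercRepro2
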